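import Summits.QuantumAdvantage.QuantumAdvantage.Theorems.InversionDialPlant

/-!
# InversionDial (part I, absorb + law) — a separator of `UInvSlice k` furnishes `L⁻¹`; ★★★ `nilRung_iff : N_k ⟺ B_k ∨ T`; Collapse Law II

Tree twin of node «InversionDial» (decomp-qadv · lens-3 · g13) §3–§4 (cut verbatim; namespace `Theorems.InversionDial`).  ABSORB: the
furnished inverse `sepInv S n N y` (entry `(i,a)` = `[code ⟨L, a, i⟩ ∈ S]`), ★ `sepInv_eq_minv` (on a promise instance a separator of
`UInvSlice k` furnishes exactly `minv L (k n)`), `acRealOver_sepInv` (the separating circuit composed with literals: depth `d_B + 1`),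
the absorbing string family `strFunS` (`strFunS_encode`, `acRealOver_strFunS`: depth `d + d_B + 5`, size `bPoly`),
★★ `nilSlice_mem_of_signer_of_inv_mem` (a table-level signer + a separator of `UInvSlice k` separate `NilSlice k`),
★★ `rungANonuniform_of_nilRung_of_not_invHard : ¬ InvHard k → NilRung k → RungANonuniform`.  LAW: ★★★ `nilRung_iff`
(`1 ≤ k n ≤ k (n+n)` ⟹ `NilRung k ↔ InvHard k ∨ RungANonuniform`), `logNilRung_iff`, `polylogNilRung_iff`, `constNilRung_iff_or`, the EQUIV
`rungANonuniform_iff_nilRung_of_not_invHard` (`¬B_k ⊢ T ⟺ N_k`), Collapse Law II `nilRung_lift_iff` / `nilSplit_iff`.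
No sorry · no instances / notation / native_decide · linter switch dupNamespace only.
-/

set_option linter.dupNamespace false

noncomputable section

namespace Summit.QuantumAdvantage.QuantumAdvantage.Theorems.InversionDial

open Finset
open Literature.Computability.Complexity
open Literature.Computability.QuantumComplexity
open Literature.Computability.MetaComplexity
open _root_.Computability (encodeNat)
open Summit.QuantumAdvantage.QuantumAdvantage.Theorems.HintDial
open Summit.QuantumAdvantage.QuantumAdvantage.Theorems.HintDial.Automaton
open Summit.QuantumAdvantage.QuantumAdvantage.Theorems.GapDial.Automaton (blockDiag blockDiag_left blockDiag_right
  mv_blockDiag bd_zero_left EE bxor_append sgl_castAdd)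
open Summit.QuantumAdvantage.QuantumAdvantage.Theorems.FlatDial (clen length_encode_eq_clen clen_injective clen_lt_clen le_clen
  tabN tabEquiv formOf pairOf tabOf pairOf_tabOf realisable signers rd pos pol ext rd_ext_encode pos_lt_clen tabN_le_clen tabN_eq
  acRealOver_parity acRealOver_and2 bit_parity signedSlice_not_mem_promiseLift_iff_no_signer length_encode_pairOf bd_bxor_left
  bd_zeroVec_left)
open Summit.QuantumAdvantage.QuantumAdvantage.Theorems.CouplingDial
open Summit.QuantumAdvantage.QuantumAdvantage.Theses.AnfPresentation (RungANonuniform RungA LiftA AnfEquiv NearExactIsExact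
  SignedExactSliceIsLift)
open CubicForm (bit)
open DerivativeWalsh (W)
open BuzetChailloux (bxor zeroVec)

variable {n : ℕ} {k k' : ℕ → ℕ}

/-! ## §3 ABSORB: a separator of `𝓑_k` FURNISHES `L⁻¹` to the g12 composition layer, so `¬B_k ∧ ¬T ⟹ ¬N_k` -/

/-- ★ THE FURNISHED INVERSE: entry `(i, a)` of the table supplied by a language `S` = `[code ⟨L, a, i⟩ ∈ S]`, `L` read off the string. -/
def sepInv (S : Language Bool) (n N : ℕ) (y : Fin N → Bool) : Fin n → Fin n → Bool := fun i a =>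
  S.boolIndicator (UInst.encode ⟨n, matRd n N y, a, i⟩)

/-- ★★ on a promise instance of the coupled slice, a separator of `𝓑_k` furnishes EXACTLY `L⁻¹`. -/
theorem sepInv_eq_minv {S : Language Bool} (hy : (UInvSlice k).yes ≤ S) (hn : (UInvSlice k).no ≤ Sᶜ) (I : CTriple)
    (hu : Unipotent I.L (k I.n)) : sepInv S I.n I.encode.length I.encode.get = minv I.L (k I.n) := by
  have hu' : Unipotent I.L (k I.n + 1) := hu.mono (Nat.le_succ _)
  funext i a
  unfold sepInv
  rw [matRd_encode]
  cases h : minv I.L (k I.n) i a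
  · exact (Set.notMem_iff_boolIndicator _ _).1 (hn ⟨⟨I.n, I.L, a, i⟩, ⟨hu, (sol_iff_minv hu' a i false).mpr h⟩, rfl⟩)
  · exact (Set.mem_iff_boolIndicator _ _).1 (hy ⟨⟨I.n, I.L, a, i⟩, ⟨hu, (sol_iff_minv hu' a i true).mpr h⟩, rfl⟩)

/-- InversionDial helper `isProj_encodeU_matRd` (decomp-qadv lens-3 g13; see the module docstring). -/
theorem isProj_encodeU_matRd {N : ℕ} (a i : Fin n) : IsProj fun y : Fin N → Bool => UInst.encode ⟨n, matRd n N y, a, i⟩ := by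
  show IsProj fun y : Fin N → Bool => boolPair (CTriple.matBits (matRd n N y)) (List.ofFn (sgl a) ++ List.ofFn (sgl i))
  exact (IsProj.ofFn _ fun q => IsProj.single (isLit_matRd _ _)).boolPair (IsProj.const _)

/-- ★ the furnished entries are `AC⁰[⊕]` over the code: the separating circuit at length `ulen n` composed with literals. -/
theorem acRealOver_sepInv {S : Language Bool} {dB : ℕ} {rB : Polynomial ℕ} {C : CircuitFamily}
    (hC : ∀ N, (C N).IsOver (accBasis 2) ∧ (C N).acDepth ≤ dB ∧ (C N).size ≤ rB.eval N) (hDec : C.Decides S)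
    (n N : ℕ) (i a : Fin n) :
    ACRealOver (accBasis 2) (fun y : Fin N → Bool => sepInv S n N y i a) (dB + 1) (rB.eval (ulen n) + ulen n) := by
  obtain ⟨s, hs⟩ := isProj_encodeU_matRd (n := n) (N := N) a i
  have hlen : s.length = ulen n := by
    have h := congrArg List.length (hs fun _ => false)
    rw [length_encodeU, List.length_map] at h
    exact h.symm
  have h := acRealOver_circuit_comp (C s.length) (hC _).1 (fun j => acRealOver_evalLit 2 (s.get j))
  refine (h.mono ?_ ?_).congr fun y => ?_
  · exact Nat.add_le_add_right (hC _).2.1 1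
  · calc (C s.length).size + ∑ _j : Fin s.length, 1 ≤ rB.eval s.length + s.length :=
          Nat.add_le_add (hC _).2.2 (by simp)
      _ = rB.eval (ulen n) + ulen n := by rw [hlen]
  · show (C s.length).eval (fun j => evalLit y (s.get j)) = sepInv S n N y i a
    rw [hDec.eval_eq, ofFn_evalLit, ← hs]
    rfl

/-- the code-length polynomial `ulen` as a polynomial. -/
def uP : Polynomial ℕ := 2 * Polynomial.X ^ 2 + 2 + 2 * Polynomial.X

/-- InversionDial helper `uP_eval` (decomp-qadv lens-3 g13; see the module docstring). -/
theorem uP_eval (n : ℕ) : uP.eval n = ulen n := by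
  simp [uP, ulen]; ring

/-- size of a furnished entry. -/
def SB (rB : Polynomial ℕ) : Polynomial ℕ := rB.comp uP + uP

/-- InversionDial helper `SB_eval` (decomp-qadv lens-3 g13; see the module docstring). -/
theorem SB_eval (rB : Polynomial ℕ) (n : ℕ) : (SB rB).eval n = rB.eval (ulen n) + ulen n := by
  simp [SB, Polynomial.eval_comp, uP_eval]

open Classical in
/-- ★ THE ABSORBING STRING FAMILY: read `L`, FURNISH `L⁻¹` from the separator, form the tables of `(F, G ∘ L⁻¹)`, apply `D n`. -/
def strFunS (D : (n : ℕ) → (Fin (tabN n) → Bool) → Bool) (S : Language Bool) (N : ℕ) (y : Fin N → Bool) : Bool :=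
  if h : ∃ n, tlen n = N then
    D (Classical.choose h) (redTab (Classical.choose h) (sepInv S (Classical.choose h) N y)
      (rd (Classical.choose h) fun i => ext y (off (Classical.choose h) + i)))
  else false

/-- InversionDial helper `strFunS_encode` (decomp-qadv lens-3 g13; see the module docstring). -/
theorem strFunS_encode (D : (n : ℕ) → (Fin (tabN n) → Bool) → Bool) (S : Language Bool) (I : CTriple) :
    strFunS D S I.encode.length I.encode.get =
      D I.n (tabOf ⟨I.n, I.F, compL I.G (sepInv S I.n I.encode.length I.encode.get)⟩) := by
  have h : ∃ n, tlen n = I.encode.length := ⟨I.n, (length_encode I).symm⟩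
  rw [strFunS, dif_pos h]
  have hn : Classical.choose h = I.n := tlen_injective ((Classical.choose_spec h).trans (length_encode I))
  rw [hn, rd_encode, redTab_tabOf]

/-- per-coordinate size and the size polynomial of the absorbing family. -/
def ZB (rB : Polynomial ℕ) : Polynomial ℕ := Polynomial.X ^ 3 * (8 * SB rB + 7) + 1

/-- InversionDial helper `ZB_eval` (decomp-qadv lens-3 g13; see the module docstring). -/
theorem ZB_eval (rB : Polynomial ℕ) (n : ℕ) : (ZB rB).eval n = n ^ 3 * (8 * (SB rB).eval n + 7) + 1 := by simp [ZB]

/-- InversionDial helper `bPoly` (decomp-qadv lens-3 g13; see the module docstring). -/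
def bPoly (rB r : Polynomial ℕ) : Polynomial ℕ := r + 2 * (Polynomial.X ^ 3 + 1) * ZB rB

/-- InversionDial helper `bPoly_eval` (decomp-qadv lens-3 g13; see the module docstring). -/
theorem bPoly_eval (rB r : Polynomial ℕ) (N : ℕ) : (bPoly rB r).eval N = r.eval N + 2 * (N ^ 3 + 1) * (ZB rB).eval N := by
  simp [bPoly]

/-- ★ the absorbing family is `AC⁰[⊕]`: depth `d + d_B + 5`, size `bPoly`. -/
theorem acRealOver_strFunS {D : (n : ℕ) → (Fin (tabN n) → Bool) → Bool} {d : ℕ} {r : Polynomial ℕ}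
    (hD : ∀ n, ACRealOver (accBasis 2) (D n) d (r.eval n)) {S : Language Bool} {dB : ℕ} {rB : Polynomial ℕ}
    {C : CircuitFamily} (hC : ∀ N, (C N).IsOver (accBasis 2) ∧ (C N).acDepth ≤ dB ∧ (C N).size ≤ rB.eval N)
    (hDec : C.Decides S) (N : ℕ) :
    ACRealOver (accBasis 2) (strFunS D S N) (d + (dB + 5)) ((bPoly rB r).eval N) := by
  rw [bPoly_eval]
  by_cases h : ∃ n, tlen n = N
  · have hN : tlen (Classical.choose h) = N := Classical.choose_spec h
    set n := Classical.choose h with hn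
    have hnN : n ≤ N := (le_clen n).trans (by rw [← hN]; unfold tlen; omega)
    have hoff : ∀ k : Fin (tabN n), off n + pos n k < N := fun k => by
      have := pos_lt_clen n k; rw [← hN]; unfold tlen off; omega
    have hSB : 1 ≤ (SB rB).eval n := by rw [SB_eval]; have := two_le_ulen n; omega
    have hc := (hD n).comp fun k =>
      acRealOver_redTabM (Mf := fun y => sepInv S n N y) hoff
        (fun i a => (acRealOver_sepInv hC hDec n N i a).mono le_rfl (le_of_eq (SB_eval rB n).symm)) (by omega) hSB k
    refine (hc.mono (by omega) ?_).congr fun y => ?_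
    · rw [sum_const, card_univ, Fintype.card_fin, smul_eq_mul, tabN_eq, triN_eq]
      simp only [ZB_eval]
      have h3 : n ^ 3 ≤ N ^ 3 := Nat.pow_le_pow_left hnN 3
      have hS : (SB rB).eval n ≤ (SB rB).eval N := natPoly_eval_mono _ hnN
      exact Nat.add_le_add (natPoly_eval_mono r hnN)
        (Nat.mul_le_mul (by omega) (Nat.add_le_add_right (Nat.mul_le_mul h3 (by omega)) 1))
    · rw [strFunS, dif_pos h]
  · have h1 : 1 ≤ (ZB rB).eval N := by rw [ZB_eval]; exact Nat.le_add_left 1 _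
    refine ((acRealOver_const (acBasis_subset_accBasis 2) false).mono (by omega) ?_).congr fun y => ?_
    · have h0 : 0 < 2 * (N ^ 3 + 1) * (ZB rB).eval N := by positivity
      exact le_add_left (Nat.succ_le_of_lt h0)
    · rw [strFunS, dif_neg h]

/-- ★★ ABSORPTION: if `𝓑_k` IS in promise-`AC⁰[⊕]`, a table-level signer of the solo slice separates `NilSlice k`. -/
theorem nilSlice_mem_of_signer_of_inv_mem (k : ℕ → ℕ) {D : (n : ℕ) → (Fin (tabN n) → Bool) → Bool}
    (hr : D ∈ realisable) (hs : D ∈ signers) (hB : UInvSlice k ∈ promiseLift (AC0Mod 2)) :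
    NilSlice k ∈ promiseLift (AC0Mod 2) := by
  obtain ⟨d, r, hD⟩ := hr
  obtain ⟨S, ⟨dB, rB, C, hC, hDec⟩, hyes, hno⟩ := hB
  choose E hE using fun N => (acRealOver_strFunS hD hC hDec N).toCircuit
  have key : ∀ I : CTriple, strFunS D S I.encode.length I.encode.get =
      D I.n (tabOf ⟨I.n, I.F, compL I.G (sepInv S I.n I.encode.length I.encode.get)⟩) := fun I => strFunS_encode D S I
  have hval : ∀ I : CTriple, Unipotent I.L (k I.n) →
      (pairOf I.n (tabOf ⟨I.n, I.F, compL I.G (sepInv S I.n I.encode.length I.encode.get)⟩)).value = I.cvalue :=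
    fun I hu => by
      have hu' : Unipotent I.L (k I.n + 1) := hu.mono (Nat.le_succ _)
      rw [pairOf_tabOf ⟨I.n, I.F, compL I.G (sepInv S I.n I.encode.length I.encode.get)⟩, sepInv_eq_minv hyes hno I hu]
      exact value_compL_of_inverse I _ (mv_mul_minv hu') (mv_minv_mul hu')
  refine ⟨{x | strFunS D S x.length x.get = true}, ⟨d + (dB + 5), bPoly rB r, E,
    fun N => ⟨(hE N).1, (hE N).2.1, (hE N).2.2.1⟩, fun x => ?_⟩, ?_, ?_⟩
  · rw [(hE x.length).2.2.2 x.get]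
    cases hx : strFunS D S x.length x.get
    · symm; exact (Set.notMem_iff_boolIndicator _ _).1 (by simp [hx])
    · symm; exact (Set.mem_iff_boolIndicator _ _).1 (by simpa using hx)
  · rintro x ⟨I, ⟨hev, hu, hv⟩, rfl⟩
    show strFunS D S I.encode.length I.encode.get = true
    rw [key I]
    exact (hs I.n _ hev).1 ((hval I hu).trans hv)
  · rintro x ⟨I, ⟨hev, hu, hv⟩, rfl⟩
    show ¬ strFunS D S I.encode.length I.encode.get = true
    rw [key I, (hs I.n _ hev).2 ((hval I hu).trans hv)]
    exact Bool.false_ne_true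

/-- ★★ `¬B_k ∧ N_k ⟹ T`: if unipotent inversion of index `k` is easy, the index-`k` coupled rung already lifts to depth one. -/
theorem rungANonuniform_of_nilRung_of_not_invHard (hB : ¬ InvHard k) (hN : NilRung k) : RungANonuniform := by
  by_contra hT
  have hex : ∃ D : (n : ℕ) → (Fin (tabN n) → Bool) → Bool, D ∈ realisable ∧ D ∈ signers := by
    by_contra hne
    exact hT (signedSlice_not_mem_promiseLift_iff_no_signer.mpr hne)
  obtain ⟨D, hr, hs⟩ := hex
  have hB' : UInvSlice k ∈ promiseLift (AC0Mod 2) := by unfold InvHard at hB; exact not_not.mp hB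
  exact hN (nilSlice_mem_of_signer_of_inv_mem k hr hs hB')

/-! ## §4 ★★★ THE DISJUNCTION LAW `N_k ⟺ B_k ∨ T` and COLLAPSE LAW II -/

/-- ★★★ THE DISJUNCTION LAW (kernel): for every schedule with `1 ≤ k(n) ≤ k(2n)`, `N_k ⟺ B_k ∨ T`. -/
theorem nilRung_iff (h1 : ∀ n, 1 ≤ k n) (h2 : ∀ n, k n ≤ k (n + n)) : NilRung k ↔ InvHard k ∨ RungANonuniform :=
  ⟨fun hN => by
    by_cases hB : InvHard k
    · exact Or.inl hB
    · exact Or.inr (rungANonuniform_of_nilRung_of_not_invHard hB hN),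
   fun h => h.elim (nilRung_of_invHard h2) (nilRung_of_rungANonuniform h1)⟩

/-- ★★ `W′ ⟺ B_log ∨ T`. -/
theorem logNilRung_iff : LogNilRung ↔ LogInvHard ∨ RungANonuniform :=
  nilRung_iff (fun _ => Nat.succ_pos _) fun n => Nat.succ_le_succ (Nat.log_mono_right (Nat.le_add_right n n))

/-- `N_{(log n)^C + 1} ⟺ B_{(log n)^C + 1} ∨ T`. -/
theorem polylogNilRung_iff (C : ℕ) :
    NilRung (fun n => Nat.log 2 n ^ C + 1) ↔ PolylogInvHard C ∨ RungANonuniform :=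
  nilRung_iff (fun _ => Nat.succ_pos _) fun n =>
    Nat.succ_le_succ (Nat.pow_le_pow_left (Nat.log_mono_right (Nat.le_add_right n n)) C)

/-- `N_{c+1} ⟺ B_{c+1} ∨ T`. -/
theorem constNilRung_iff_or (c : ℕ) : ConstNilRung c ↔ ConstInvHard c ∨ RungANonuniform :=
  nilRung_iff (fun _ => Nat.succ_pos c) fun _ => le_rfl

/-- ★★★ THE SINGLE ALLOWED EQUIV OF THE NODE, CERTIFIED: modulo `¬B_k`, the index-`k` rung IS the target. -/
theorem rungANonuniform_iff_nilRung_of_not_invHard (h1 : ∀ n, 1 ≤ k n) (hB : ¬ InvHard k) : RungANonuniform ↔ NilRung k :=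
  ⟨nilRung_of_rungANonuniform h1, rungANonuniform_of_nilRung_of_not_invHard hB⟩

/-- ★★ COLLAPSE LAW II (lift form): the lift of ANY rung `N_k` of the axis is exactly the lift of the T-free statement `B_k`. -/
theorem nilRung_lift_iff (h1 : ∀ n, 1 ≤ k n) (h2 : ∀ n, k n ≤ k (n + n)) :
    (NilRung k → RungANonuniform) ↔ (InvHard k → RungANonuniform) :=
  ⟨fun h b => h (nilRung_of_invHard h2 b), fun h w => ((nilRung_iff h1 h2).mp w).elim h id⟩

/-- ★★ COLLAPSE LAW II (split form): the g12 split `T ⟸ N_k ∧ (N_k → T)` is literally `T ⟸ (B_k ∨ T) ∧ (B_k → T)`. -/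
theorem nilSplit_iff (h1 : ∀ n, 1 ≤ k n) (h2 : ∀ n, k n ≤ k (n + n)) :
    (NilRung k ∧ (NilRung k → RungANonuniform)) ↔ ((InvHard k ∨ RungANonuniform) ∧ (InvHard k → RungANonuniform)) :=
  and_congr (nilRung_iff h1 h2) (nilRung_lift_iff h1 h2)

end Summit.QuantumAdvantage.QuantumAdvantage.Theorems.InversionDial

end
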